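import Summits.BirchSwinnertonDyer.BirchSwinnertonDyer.Theorems.ManinLocalTwoThreeShimuraIndexDichotomy
import Summits.BirchSwinnertonDyer.BirchSwinnertonDyer.Theorems.ManinLocalTwoThreeThreeBlindInvariance
import Literature.NumberTheory.EllipticCurves.WeilPairingProofs
import Literature.NumberTheory.EllipticCurves.OpenImageMazurProofs
import Literature.NumberTheory.EllipticCurves.ThreeDivisionFieldSwanProofs
import HarnessLib

/-!
# The `μ₃`-configuration in coordinates (Weil pairing): a stable `3`-line with trivial quotient character is `μ₃`
# — part 1 of 2 (part 2: `ManinLocalTwoThreeShimuraIndexMuThree.lean`: short model, E-es-67 ⟸ E-es-67♯, E-an-128 ⟸ its `μ₃`-form)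

Summit `BirchSwinnertonDyer`, route `ManinLocalTwoThree` (cell bsd-f2-manin), crux C3 `ManinPrimeToThreeAtNine`
(stmt-BirchSwinnertonDyer-22968; also C2 stmt-BirchSwinnertonDyer-22967).  Prover seat bsd-line-manin23-p1 (C2/C3 LEAD), gen 9;
sequel to `ManinLocalTwoThreeShimuraIndexDichotomy.lean`.

* `exists_isRoot_Ψ₃_and_sq_eq_neg_three_mul_sq_of_trivialQuotientLine` — for an elliptic `W/ℚ` and a `Γ_ℚ`-stable `3`-line
  `H ≤ W[3]` with TRIVIAL quotient character (`σT − T ∈ H`): `H = {O, ±P}` with `x(P) = x₀ ∈ ℚ`, `Ψ₃(x₀) = 0` and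
  `(2y + a₁x₀ + a₃)² = 4x₀³ + b₂x₀² + 2b₄x₀ + b₆ = −3t₀²`, `t₀ ∈ ℚˣ` — i.e. `H ≅ μ₃`: by the WEIL PAIRING (tree
  `exists_weilPairing_holds`: bilinear, alternating, non-degenerate, Galois-equivariant) `ζ = e₃(Q, P)` is a primitive cube root
  of unity on which every `σ` acts by the same sign as on `P` (`det ρ̄ = ω` on the line), so `(2y + a₁x + a₃)·(2ζ + 1)` is
  `Γ_ℚ`-fixed, hence rational, and `(2ζ + 1)² = −3`.
* `hasShortMuThree_of_trivialQuotientLine` — transported to the short model `E_{W,c}` (`X₀ = c²(x₀ + b₂/12)`,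
  `Ψ₃^{E_{W,c}}(X₀) = c⁸Ψ₃(x₀)`, `X₀³ + a₄X₀ + a₆ = c⁶(4x₀³ + b₂x₀² + 2b₄x₀ + b₆)/4`): `HasShortMuThree W c`.
* `exists_isShortThreeTorsion_of_addOrderOf_eq_three` — a rational point of order `3` on `W` gives `IsShortThreeTorsion W c X₀ Y₀`.
* **`exists_isShortThreeTorsion_or_hasShortMuThree_of_not_shimuraIndexPrimeTo_three`** — `3 ∣ [Λ₀(f) : Λ₁(f)]` ⟹ a rational
  `3`-torsion point on `E_{W,c}` OR `μ₃ ⊂ W` (`HasShortMuThree W c`), every level, every `c ≠ 0`, no optimality.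
* **`plusIndexPrimeToThreeOfNoRationalThreeTorsion_of_sharp`** — es's E-es-67 `PlusIndexPrimeToThreeOfNoRationalThreeTorsion` from
  E-es-67♯ `PlusIndexPrimeToThreeOfMuThreeNoRationalThreeTorsion` ALONE (the leaf's `…_of_halves` needed E-es-67♮ too);
  `plusIndexPrimeTo_three_of_no_shortThreeTorsion_of_not_hasShortMuThree` — the unconditional part.
* **`shimuraThreeForcesRationalThreeTorsion_of_muThree`** — an's E-an-128 `ShimuraThreeForcesRationalThreeTorsion` from the single
  residual law «lattice-optimal `W` with `μ₃ ⊂ W` and no rational `3`-torsion has `3 ∤ [Λ₀ : Λ₁]`» (stated inline).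

HONEST FRAMING: unconditional tree theorems except the two displayed reductions, whose hypotheses (E-es-67♯, the `μ₃`-residual) are
OPEN cell laws.  No crux stub is narrowed; C2, C3, Manin's conjecture and BSD are NOT proved by this file.  No definitions, no sorry.

References: J. H. Silverman, *AEC* III.8.1 (Weil pairing), Ex. 3.7 [SilvermanAEC2009]; Cornell–Silverman–Stevens II §§7–8
(`det ρ̄ = χ`) [SilvermanCSS1997]; N. M. Katz, Invent. Math. 62 (1981) Thm. 2 [Katz1980]; K. Ribet [Ribet1988Shimura].
-/

set_option autoImplicit false
set_option linter.dupNamespace false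

noncomputable section

open scoped Classical MatrixGroups ModularForm

open CongruenceSubgroup WeierstrassCurve Field Polynomial Literature.NumberTheory.EllipticCurves
  Literature.NumberTheory.EllipticCurves.ModularForms
open Summit.BirchSwinnertonDyer.Rank1Residual.ManinAdditive.KatoCurve
  Summit.BirchSwinnertonDyer.Rank1Residual.ManinAdditive.CuspidalKummer
  Summit.BirchSwinnertonDyer.Rank1Residual.ManinAdditive.CuspidalKummerThree

namespace Summit.BirchSwinnertonDyer.BirchSwinnertonDyer.Theorems.ManinLocalTwoThree

/-! ### §0. Galois descent for a scalar -/

/-- An element of `ℚ̄` fixed by every `ℚ`-automorphism of `ℚ̄` is rational (`ℚ̄/ℚ` is Galois; Mathlib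
`InfiniteGalois.mem_range_algebraMap_iff_fixed`). [folklore] -/
theorem exists_ratCast_algebraMap_eq_of_forall_algEquiv_eq {x : AlgebraicClosure ℚ}
    (hx : ∀ σ : AlgebraicClosure ℚ ≃ₐ[ℚ] AlgebraicClosure ℚ, σ x = x) :
    ∃ c : ℚ, algebraMap ℚ (AlgebraicClosure ℚ) c = x := by
  have hG : ∀ {K : Type} [Field K] [CharZero K], IsGalois K (AlgebraicClosure K) := fun {K} _ _ ↦ {}
  haveI : IsGalois ℚ (AlgebraicClosure ℚ) := hG
  exact (InfiniteGalois.mem_range_algebraMap_iff_fixed x).mpr hx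

/-! ### §1. A stable `3`-line with trivial quotient character is `μ₃`: coordinates -/

/-- **The `μ₃`-configuration in coordinates (Weil pairing).**  Let `W/ℚ` be elliptic and `H ≤ W[3]` a `Γ_ℚ`-stable subgroup of
order `3` with `σ • T − T ∈ H` for all `σ ∈ Γ_ℚ`, `T ∈ W[3]`.  Then there are `x₀ ∈ ℚ` and `t₀ ∈ ℚˣ` with `Ψ₃(x₀) = 0` and
`4x₀³ + b₂x₀² + 2b₄x₀ + b₆ = −3t₀²` (the points of `H ∖ {O}` are `(x₀, y)` with `2y + a₁x₀ + a₃ ∈ √−3·ℚˣ`).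
Proof: `H = {O, ±P}`, `σP = ±P`, so `σ` fixes `x(P)`; with the Weil pairing `e₃` and `Q ∈ W[3]` with `ζ := e₃(Q, P) ≠ 1`
(non-degeneracy), `σζ = e₃(σQ, σP) = e₃(Q + S, ±P) = ζ^{±1}` (`S ∈ H`, bilinearity, `e₃(P, P) = 1`), so `σ` acts on the primitive
cube root `ζ` by the same sign as on `P`; hence `(2y + a₁x + a₃)(2ζ + 1)` is fixed by `Γ_ℚ`, and `(2ζ + 1)² = −3`.
[cite: SilvermanAEC2009, Prop. III.8.1 and Exercise 3.7] [cite: SilvermanCSS1997, Ch. II §§7–8] -/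
theorem exists_isRoot_Ψ₃_and_sq_eq_neg_three_mul_sq_of_trivialQuotientLine (W : WeierstrassCurve ℚ) [W.IsElliptic]
    {H : AddSubgroup (W.geomTorsion 3)} (hH : Nat.card H = 3)
    (hst : ∀ σ : absoluteGaloisGroup ℚ, ∀ a ∈ H, σ • a ∈ H)
    (htriv : ∀ (σ : absoluteGaloisGroup ℚ) (T : W.geomTorsion 3), σ • T - T ∈ H) :
    ∃ x₀ t₀ : ℚ, W.Ψ₃.IsRoot x₀ ∧ t₀ ≠ 0 ∧
      4 * x₀ ^ 3 + W.b₂ * x₀ ^ 2 + 2 * W.b₄ * x₀ + W.b₆ = -3 * t₀ ^ 2 := by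
  haveI : Fact (Nat.Prime 3) := ⟨Nat.prime_three⟩
  haveI : NeZero ((3 : ℕ) : ℚ) := ⟨by norm_num⟩
  set Kb := AlgebraicClosure ℚ with hKb
  obtain ⟨P, hP0, rfl⟩ := Mazur1978.exists_eq_zmultiples_of_natCard_eq W 3 hH
  -- `3P = 0`, `2P = -P`
  have h2P : (2 : ℕ) • P = -P := by
    have h3 : (2 : ℕ) • P + P = 0 := by
      rw [← succ_nsmul]
      exact AddSubgroup.torsionBy.nsmul P
    exact eq_neg_of_add_eq_zero_left h3
  have h3P : (3 : ℤ) • P = 0 := by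
    have h3 : (2 : ℕ) • P + P = 0 := by
      rw [← succ_nsmul]
      exact AddSubgroup.torsionBy.nsmul P
    rw [show (3 : ℤ) = ((2 : ℕ) : ℤ) + 1 by norm_num, add_zsmul, one_zsmul, natCast_zsmul]
    exact h3
  have hPneg : P ≠ -P := by
    intro h
    apply hP0
    have h2 : (2 : ℕ) • P = P := by rw [h2P, ← h]
    have : P + P = P := by rw [← two_nsmul]; exact h2
    simpa using this
  -- elements of the line `ℤP` are `0, P, -P`
  have hline : ∀ S ∈ AddSubgroup.zmultiples P, S = 0 ∨ S = P ∨ S = -P := by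
    intro S hS
    obtain ⟨k, rfl⟩ := AddSubgroup.mem_zmultiples_iff.mp hS
    obtain ⟨q, r, hkqr, hr⟩ : ∃ q r : ℤ, k = r + q * 3 ∧ (r = 0 ∨ r = 1 ∨ r = 2) :=
      ⟨k / 3, k % 3, by omega, by omega⟩
    have hk3 : k • P = r • P := by
      rw [hkqr, add_zsmul, mul_zsmul, h3P, zsmul_zero, add_zero]
    rw [hk3]
    rcases hr with h | h | h
    · left; rw [h, zero_zsmul]
    · right; left; rw [h, one_zsmul]
    · right; right
      rw [h, show (2 : ℤ) = ((2 : ℕ) : ℤ) by norm_num, natCast_zsmul, h2P]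
  -- `σ • P = P` or `σ • P = -P`
  have hpm : ∀ σ : absoluteGaloisGroup ℚ, σ • P = P ∨ σ • P = -P := by
    intro σ
    have hmem : σ • P ∈ AddSubgroup.zmultiples P := hst σ P (AddSubgroup.mem_zmultiples P)
    have hσ0 : σ • P ≠ 0 := by
      intro h0
      apply hP0
      have := congrArg (fun Q ↦ σ⁻¹ • Q) h0
      simpa using this
    rcases hline _ hmem with h | h | h
    · exact (hσ0 h).elim
    · exact Or.inl h
    · exact Or.inr h
  -- `σ • Q = Q + S` with `S ∈ {0, P, -P}`
  have hmove : ∀ (σ : absoluteGaloisGroup ℚ) (Q : W.geomTorsion 3),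
      σ • Q = Q ∨ σ • Q = Q + P ∨ σ • Q = Q + -P := by
    intro σ Q
    rcases hline _ (htriv σ Q) with h | h | h
    · left; exact sub_eq_zero.mp h
    · right; left; rw [← h]; abel
    · right; right; rw [← h]; abel
  -- THE WEIL PAIRING `e₃`
  obtain ⟨e, hpow, haddl, haddr, hself, hnondeg, hgal⟩ := W.exists_weilPairing_holds 3 (by norm_num) (by norm_num)
  have hne0 : ∀ S T, e S T ≠ 0 := fun S T h ↦ by
    have := hpow S T
    rw [h, zero_pow three_ne_zero] at this
    exact zero_ne_one this
  have he0l : ∀ T, e 0 T = 1 := fun T ↦ by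
    have h := haddl 0 0 T
    rw [add_zero] at h
    exact (mul_eq_left₀ (hne0 0 T)).mp h.symm
  have he0r : ∀ S, e S 0 = 1 := fun S ↦ by
    have h := haddr S 0 0
    rw [add_zero] at h
    exact (mul_eq_left₀ (hne0 S 0)).mp h.symm
  have henegl : ∀ S T, e (-S) T * e S T = 1 := fun S T ↦ by rw [← haddl, neg_add_cancel, he0l]
  have henegr : ∀ S T, e S (-T) * e S T = 1 := fun S T ↦ by rw [← haddr, neg_add_cancel, he0r]
  -- `e S P = 1` and `e S (-P) = 1` for `S` on the line
  have hPP : e P (-P) = 1 := by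
    have h := henegr P P
    rwa [hself P, mul_one] at h
  have hnPP : e (-P) P = 1 := by
    have h := henegl P P
    rwa [hself P, mul_one] at h
  have hlineP : ∀ S, S = 0 ∨ S = P ∨ S = -P → e S P = 1 ∧ e S (-P) = 1 := by
    intro S hS
    rcases hS with h | h | h <;> rw [h]
    · exact ⟨he0l P, he0l (-P)⟩
    · exact ⟨hself P, hPP⟩
    · exact ⟨hnPP, hself (-P)⟩
  -- a partner `Q` with `ζ := e Q P ≠ 1` (non-degeneracy)
  obtain ⟨Q, hQ⟩ : ∃ Q, e Q P ≠ 1 := by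
    by_contra hall
    push Not at hall
    exact hP0 (hnondeg P hall)
  set ζ := e Q P with hζ
  have hζ3 : ζ ^ 3 = 1 := hpow Q P
  have hζ2 : ζ ^ 2 = -ζ - 1 := by
    have h : (ζ - 1) * (ζ ^ 2 + ζ + 1) = 0 := by ring_nf; linear_combination hζ3
    rcases mul_eq_zero.mp h with h | h
    · exact absurd (sub_eq_zero.mp h) hQ
    · linear_combination h
  have hζinv : e Q (-P) = ζ ^ 2 := by
    have h := henegr Q P
    -- `e Q (-P) * ζ = 1`, and `ζ² * ζ = 1`
    have h2 : ζ ^ 2 * ζ = 1 := by rw [← pow_succ]; exact hζ3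
    have hζ0 : ζ ≠ 0 := hne0 Q P
    exact mul_right_cancel₀ hζ0 (h.trans h2.symm)
  set θ := 2 * ζ + 1 with hθ
  have hθsq : θ ^ 2 = -3 := by rw [hθ]; linear_combination (4 : Kb) * hζ2
  have hθ0 : θ ≠ 0 := fun h ↦ by rw [h] at hθsq; norm_num at hθsq
  -- scalar action of `σ` = application of the underlying automorphism
  have hsm : ∀ (σ : absoluteGaloisGroup ℚ) (z : Kb), σ • z = (show Kb ≃ₐ[ℚ] Kb from σ) z := fun _ _ ↦ rfl
  -- `σ ζ = ζ` if `σP = P`, `σ ζ = ζ²` if `σP = -P`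
  have hσζ : ∀ σ : absoluteGaloisGroup ℚ, (σ • P = P → σ • ζ = ζ) ∧ (σ • P = -P → σ • ζ = ζ ^ 2) := by
    intro σ
    have hg : σ • ζ = e (σ • Q) (σ • P) := hgal σ Q P
    constructor
    · intro hP
      rw [hg, hP]
      rcases hmove σ Q with h | h | h
      · rw [h]
      · rw [h, haddl, (hlineP P (Or.inr (Or.inl rfl))).1, mul_one]
      · rw [h, haddl, (hlineP (-P) (Or.inr (Or.inr rfl))).1, mul_one]
    · intro hP
      rw [hg, hP]
      rcases hmove σ Q with h | h | h
      · rw [h, hζinv]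
      · rw [h, haddl, (hlineP P (Or.inr (Or.inl rfl))).2, mul_one, hζinv]
      · rw [h, haddl, (hlineP (-P) (Or.inr (Or.inr rfl))).2, mul_one, hζinv]
  -- hence `σ θ = ± θ` with the sign of `σ` on `P`
  have hσθ : ∀ σ : absoluteGaloisGroup ℚ, (σ • P = P → σ • θ = θ) ∧ (σ • P = -P → σ • θ = -θ) := by
    intro σ
    set τ : Kb ≃ₐ[ℚ] Kb := σ with hτ
    have h2 : τ (2 : Kb) = 2 := map_ofNat τ 2
    have hζ' : σ • ζ = τ ζ := hsm σ ζ
    constructor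
    · intro hP
      have h1 : τ ζ = ζ := by rw [← hζ']; exact (hσζ σ).1 hP
      rw [hsm, hθ]
      change τ (2 * ζ + 1) = 2 * ζ + 1
      rw [map_add, map_mul, map_one, h1, h2]
    · intro hP
      have h1 : τ ζ = ζ ^ 2 := by rw [← hζ']; exact (hσζ σ).2 hP
      rw [hsm, hθ]
      change τ (2 * ζ + 1) = -(2 * ζ + 1)
      rw [map_add, map_mul, map_one, h1, h2, hζ2]; ring
  -- coordinates of `P = (x, y)`
  obtain ⟨Pt, hPmem⟩ := P
  have hPt0 : Pt ≠ 0 := fun h ↦ hP0 (Subtype.ext h)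
  change (W.baseChange Kb).toAffine.Point at Pt
  rcases Pt with _ | ⟨x, y, hxy⟩
  · exact (hPt0 rfl).elim
  set ι := algebraMap ℚ Kb with hι
  have ha₁ : (W.baseChange Kb).a₁ = ι W.a₁ := rfl
  have ha₂ : (W.baseChange Kb).a₂ = ι W.a₂ := rfl
  have ha₃ : (W.baseChange Kb).a₃ = ι W.a₃ := rfl
  have ha₄ : (W.baseChange Kb).a₄ = ι W.a₄ := rfl
  have ha₆ : (W.baseChange Kb).a₆ = ι W.a₆ := rfl
  have hnegY : (W.baseChange Kb).toAffine.negY x y = -y - ι W.a₁ * x - ι W.a₃ := rfl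
  set w : Kb := 2 * y + ι W.a₁ * x + ι W.a₃ with hw
  -- `σ x = x`; `σ w = ± w` with the sign of `σ` on `P`
  have hσxy : ∀ σ : absoluteGaloisGroup ℚ, σ • x = x ∧
      ((σ • (⟨Affine.Point.some x y hxy, hPmem⟩ : W.geomTorsion 3) = ⟨Affine.Point.some x y hxy, hPmem⟩ →
          σ • w = w) ∧
       (σ • (⟨Affine.Point.some x y hxy, hPmem⟩ : W.geomTorsion 3) = -⟨Affine.Point.some x y hxy, hPmem⟩ →
          σ • w = -w)) := by
    intro σ
    set τ : Kb ≃ₐ[ℚ] Kb := σ with hτ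
    have hfix : ∀ a : ℚ, τ (ι a) = ι a := fun a ↦ τ.commutes a
    have h2 : τ (2 : Kb) = 2 := map_ofNat τ 2
    rw [hsm σ x, hsm σ w]
    change τ x = x ∧ (_ → τ w = w) ∧ (_ → τ w = -w)
    rcases hpm σ with hσ | hσ
    · have hσ' := congrArg Subtype.val hσ
      change Affine.Point.map (τ : Kb →ₐ[ℚ] Kb) (Affine.Point.some x y hxy) = Affine.Point.some x y hxy at hσ'
      rw [Affine.Point.map_some] at hσ'
      obtain ⟨hxx, hyy⟩ := Affine.Point.some.inj hσ'
      simp only [AlgEquiv.coe_toAlgHom] at hxx hyy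
      refine ⟨hxx, fun _ ↦ ?_, fun h ↦ absurd (hσ.symm.trans h) hPneg⟩
      rw [hw, map_add, map_add, map_mul, map_mul, hxx, hyy, hfix, hfix, h2]
    · have hσ' := congrArg Subtype.val hσ
      change Affine.Point.map (τ : Kb →ₐ[ℚ] Kb) (Affine.Point.some x y hxy) = -Affine.Point.some x y hxy at hσ'
      rw [Affine.Point.map_some, Affine.Point.neg_some] at hσ'
      obtain ⟨hxx, hyy⟩ := Affine.Point.some.inj hσ'
      simp only [AlgEquiv.coe_toAlgHom] at hxx hyy
      rw [hnegY] at hyy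
      refine ⟨hxx, fun h ↦ absurd (hσ.symm.trans h).symm hPneg, fun _ ↦ ?_⟩
      rw [hw, map_add, map_add, map_mul, map_mul, hxx, hyy, hfix, hfix, h2]
      ring
  -- `u := w θ` is fixed by `Γ_ℚ`
  have hσu : ∀ τ : Kb ≃ₐ[ℚ] Kb, τ (w * θ) = w * θ := by
    intro τ
    have hθ' : τ θ = (show absoluteGaloisGroup ℚ from τ) • θ := (hsm τ θ).symm
    have hw' : τ w = (show absoluteGaloisGroup ℚ from τ) • w := (hsm τ w).symm
    rw [map_mul, hθ', hw']
    rcases hpm τ with hσ | hσ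
    · rw [((hσxy τ).2).1 hσ, (hσθ τ).1 hσ]
    · rw [((hσxy τ).2).2 hσ, (hσθ τ).2 hσ]; ring
  have hσx : ∀ τ : Kb ≃ₐ[ℚ] Kb, τ x = x := fun τ ↦ by
    rw [← hsm τ x]; exact (hσxy τ).1
  obtain ⟨r₀, hr₀⟩ := exists_ratCast_algebraMap_eq_of_forall_algEquiv_eq hσu
  obtain ⟨x₀, hx₀⟩ := exists_ratCast_algebraMap_eq_of_forall_algEquiv_eq hσx
  -- `w ≠ 0` (`P ≠ -P`)
  have hw0 : w ≠ 0 := by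
    intro hw0
    apply hPneg
    apply Subtype.ext
    change Affine.Point.some x y hxy = -Affine.Point.some x y hxy
    rw [Affine.Point.neg_some]
    have hw0' : 2 * y + ι W.a₁ * x + ι W.a₃ = 0 := by rw [← hw]; exact hw0
    have hyneg : y = (W.baseChange Kb).toAffine.negY x y := by
      rw [hnegY]; linear_combination hw0'
    simp only [Affine.Point.some.injEq, true_and]
    exact hyneg
  -- the Weierstrass equation gives `w² = 4x³ + b₂x² + 2b₄x + b₆`
  have heq : y ^ 2 + ι W.a₁ * x * y + ι W.a₃ * y = x ^ 3 + ι W.a₂ * x ^ 2 + ι W.a₄ * x + ι W.a₆ := by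
    have h := (Affine.equation_iff_nonsingular.mpr hxy)
    rw [Affine.equation_iff] at h
    exact h
  have hwsq0 : (2 * y + ι W.a₁ * x + ι W.a₃) ^ 2 = 4 * x ^ 3 + ι W.b₂ * x ^ 2 + 2 * ι W.b₄ * x + ι W.b₆ := by
    simp only [WeierstrassCurve.b₂, WeierstrassCurve.b₄, WeierstrassCurve.b₆, map_add, map_mul, map_pow,
      map_ofNat]
    linear_combination (4 : Kb) * heq
  have hwsq : w ^ 2 = 4 * x ^ 3 + ι W.b₂ * x ^ 2 + 2 * ι W.b₄ * x + ι W.b₆ := by rw [hw]; exact hwsq0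
  -- `(w θ)² = -3 w²`, everything rational
  have hkey : ι (4 * x₀ ^ 3 + W.b₂ * x₀ ^ 2 + 2 * W.b₄ * x₀ + W.b₆) = ι (-3 * (r₀ / 3) ^ 2) := by
    have h1 : (w * θ) ^ 2 = w ^ 2 * θ ^ 2 := by ring
    rw [hθsq, hwsq, ← hx₀, ← hr₀] at h1
    simp only [map_add, map_mul, map_pow, map_neg, map_div₀, map_ofNat]
    linear_combination (1 / 3 : Kb) * h1
  have hr₀0 : r₀ ≠ 0 := by
    rintro rfl
    rw [map_zero] at hr₀
    exact mul_ne_zero hw0 hθ0 hr₀.symm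
  -- `Ψ₃(x₀) = 0`
  have hΨ : (W.baseChange Kb).Ψ₃.eval x = 0 :=
    W.eval_divisionPolynomial_three_eq_zero_of_eq_some (T := ⟨Affine.Point.some x y hxy, hPmem⟩) rfl
  rw [← hx₀, WeierstrassCurve.baseChange, map_Ψ₃, eval_map] at hΨ
  have hΨ' : ι (W.Ψ₃.eval x₀) = 0 := by rwa [hι, ← eval₂_at_apply]
  refine ⟨x₀, r₀ / 3, (map_eq_zero_iff _ ι.injective).mp hΨ', div_ne_zero hr₀0 three_ne_zero, ι.injective hkey⟩

end Summit.BirchSwinnertonDyer.BirchSwinnertonDyer.Theorems.ManinLocalTwoThree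

end
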